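import Literature.AlgebraicGeometry.ModuliOfAbelianVarieties.SiegelLinearRigidificationBaseChange
import Literature.AlgebraicGeometry.ModuliOfAbelianVarieties.SiegelFramedCovariant
import Literature.AlgebraicGeometry.Morphisms.ProjectiveFrameLocusLinearInvariance
import Literature.AlgebraicGeometry.AbelianSchemes.PolarizedAbelianSchemeWithLevelBaseChangeCancel
import HarnessLib

/-!
# The open sub-functors `𝓕_R` of the Siegel moduli functor: «the `R`-marked torsion points are a frame»

Topic `AlgebraicGeometry/ModuliOfAbelianVarieties`; namespace
`Literature.AlgebraicGeometry.AbelianSchemes.PolarizedAbelianSchemeWithLevel`.  THEOREMS ONLY (the definitions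
`markedTuple` / `frameOpen` / `IsFrameOn` are ★ `ModuliOfAbelianVarieties/SiegelFramedCovariant` §4); no named fact,
no instance, no `sorry`.  §§ 1–2 are B-typ04 (g13)'s bytes (cell hodgecm-mathlib, F-8 path (8β)), § 3 by B-p11 (g17).

[MumfordFogartyKirwan1994] Ch. 7 §2–3 (pp. 129–138) with Ch. 3 §1 (p. 68): for a polarised abelian scheme with level
structure `P = (X/T, λ, σ)` and a LINEAR RIGIDIFICATION `ι : X → 𝐏^m` (Def. 7.5), the `N^{2g}` torsion sections give
`T`-valued points `σ^a ≫ ι` of `𝐏^m`; for `m + 2` of them, indexed by `R`, MFK's open set `U_R` («(i) `D_{0…n} ≠ 0`,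
(ii) …», Def. 3.3) pulls back to the open `U_R(P) ⊆ T` where they form a projective frame.  Since `U_R` is
`PGL(m+1)`-stable (Prop. 3.1) and two linear rigidifications differ locally by `GL(m+1)` (Prop. 7.6), `U_R(P)` does
not depend on the rigidification, and `T ↦ {P : U_R(P) = T}` is an OPEN SUB-FUNCTOR `𝓕_R` of the moduli functor
(the functor the `R`-slice of Prop. 7.3's `H` represents).

* § 1 the marked tuple `markedTuple P ι R` under relations (`comp_markedTuple`, ★ `IsBaseChangeVia.sectionPow_comp`),
  under base change, and under `M ∈ GL_{m+1}(Γ(T, 𝒪_T))` acting on the embedding (`markedTuple_lift_actCore`,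
  ★ `comp_lift_actCore`) — hence **`frameLocus_markedTuple_lift_actCore`** (★ `frameLocus_lift_actCore`);
* § 2 `frameOpen P R` / `IsFrameOn P R`: every local linear rigidification contributes its frame locus, and
  **`preimage_frameOpen_le`**: along a relation `P″ ≅ u^*P`, `u⁻¹ U_R(P) ≤ U_R(P″)` (linear rigidifications pull
  back, ★ `IsBaseChangeVia.isLinearRigidification_comp`; ★ `preimage_frameLocus`) — so `𝓕_R` is a sub-functor
  (`IsFrameOn.of_isBaseChangeVia`);
* § 3 under the inputs **(hGL)** «two linear rigidifications of one triple differ Zariski-locally by `GL_{m+1}`»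
  and **(hLR)** «`P` is Zariski-locally linearly rigidifiable» (honest hypotheses, heads of the sibling files
  `SiegelLinearRigidificationUnique` / `PolarizedLevelLocallyRigidifiable`): **`frameOpen_eq_frameLocus`** (ANY global
  rigidification computes `U_R`), **`frameOpen_inf_eq`** (local form), **`preimage_frameOpen`**
  (`u⁻¹ U_R(P) = U_R(P″)`) and the consumer clause **`isFrameOn_iff_preimage_frameOpen_eq_top`** (the binder `hFr` of
  ★ `SiegelFineModuliScheme.classify_of_openCharts`).

COUNT-NEUTRAL capital: HC_CM is proved only modulo the 7 printed citations until rung 0 closes; nothing here is about HC.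

## References
* [MumfordFogartyKirwan1994] D. Mumford, J. Fogarty, F. Kirwan, *Geometric Invariant Theory*, 3rd ed. (1994): Ch. 3 §1
  Def. 3.3, Prop. 3.1 (p. 68); Ch. 7 §2 Def. 7.2 (p. 129), Def. 7.5 (p. 130), Prop. 7.6 (p. 136); §3 Prop. 7.7 (p. 138).
* [GortzWedhorn2020] U. Görtz, T. Wedhorn, *Algebraic Geometry I: Schemes*, 2nd ed. (2020): Definition 4.44 (p. 117).
-/

noncomputable section

set_option backward.isDefEq.respectTransparency false

open CategoryTheory CategoryTheory.Limits AlgebraicGeometry Matrix TopologicalSpace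
open Literature.AlgebraicGeometry.Morphisms (intU projectiveSpaceInt isPullback_projToSpec_projMap_terminal)
open Literature.AlgebraicGeometry.Morphisms.ProjFrame (frameLocus preimage_frameLocus comp_lift_actCore frameLocus_lift_actCore)
open Literature.AlgebraicGeometry.GroupSchemes.GeneralLinearGroupScheme (intCast actCore)

namespace Literature.AlgebraicGeometry.AbelianSchemes

namespace PolarizedAbelianSchemeWithLevel

variable {g N : ℕ} {δ : Fin g → ℕ} (J : Type)

/-! ## § 1 The marked tuple under relations, base change and the action on the embedding -/

section Marked

variable {T : Scheme.{0}} (P : PolarizedAbelianSchemeWithLevel g N δ T)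
  (ι : P.A.X.left ⟶ projectiveSpaceInt J) (R : Fin (Nat.card J + 2) → (Fin g ⊕ Fin g → ZMod N))

variable {P ι} in
/-- **Marked points under a relation**: if `P″` over `T″` is the pull-back of `P` along `u` via `(G, Ĝ)`, the marked
points of `(P″, G ≫ ι)` are `u ≫` those of `(P, ι)` (the level clause `σ″ ≫ G = u ≫ σ` multiplied out,
★ `IsBaseChangeVia.sectionPow_comp`). [cite: MumfordFogartyKirwan1994, Ch. 7 §2 Definition 7.2 (p. 129)] -/
theorem comp_markedTuple {T'' : Scheme.{0}} {P'' : PolarizedAbelianSchemeWithLevel g N δ T''} {u : T'' ⟶ T}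
    {G : P''.A.X.left ⟶ P.A.X.left} {Ĝ : P''.D.hat.X.left ⟶ P.D.hat.X.left} (h : P''.IsBaseChangeVia P u G Ĝ)
    (j : Fin (Nat.card J + 2)) : u ≫ markedTuple J P ι R j = markedTuple J P'' (G ≫ ι) R j := by
  rw [markedTuple_apply, markedTuple_apply, ← Category.assoc, ← h.1.1.sectionPow_comp h.1.2 (R j), Category.assoc]

/-- Base change to `T' → T`: the marked points of `P|_{T'}` through the restricted embedding are the restricted marked
points. [cite: MumfordFogartyKirwan1994, Ch. 7 §2 Definition 7.2 (p. 129)] -/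
theorem markedTuple_baseChange {T' : Scheme.{0}} (u : T' ⟶ T) (j : Fin (Nat.card J + 2)) :
    markedTuple J (P.baseChange u) (pullback.fst P.A.X.hom u ≫ ι) R j = u ≫ markedTuple J P ι R j :=
  (comp_markedTuple J R (P.baseChange_isBaseChangeVia u) j).symm

/-- Hence the frame locus of the marked points commutes with base change: `u⁻¹ (frame locus over T) =` the frame
locus of the base-changed rigidified triple (★ `ProjFrame.preimage_frameLocus`). [cite: MumfordFogartyKirwan1994, Ch. 3 Definition 3.3] -/
theorem preimage_frameLocus_markedTuple {T' : Scheme.{0}} (u : T' ⟶ T) :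
    u ⁻¹ᵁ frameLocus (markedTuple J P ι R) =
      frameLocus (markedTuple J (P.baseChange u) (pullback.fst P.A.X.hom u ≫ ι) R) := by
  rw [preimage_frameLocus]
  exact congrArg frameLocus (funext fun j => (markedTuple_baseChange J P ι R u j).symm)

/-- A section `s : T → X` of `π : X → T` pulls the matrix `π^* M` back to `M` (`s^* π^* = id` on `Γ(T, 𝒪_T)`).
[folklore] -/
private theorem map_map_appTop_section (s : P.A.Sections) (M : GL (Fin (Nat.card J + 1)) Γ(T, ⊤)) :
    Matrix.GeneralLinearGroup.map s.left.appTop.hom (Matrix.GeneralLinearGroup.map P.A.X.hom.appTop.hom M) = M := by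
  have hs : s.left ≫ P.A.X.hom = 𝟙 T := Over.w s
  have h : s.left.appTop.hom.comp P.A.X.hom.appTop.hom = RingHom.id _ := by
    rw [← CommRingCat.hom_comp, ← Scheme.Hom.comp_appTop, hs, Scheme.Hom.id_appTop]
    rfl
  ext i j
  change (s.left.appTop.hom.comp P.A.X.hom.appTop.hom) (M i j) = M i j
  rw [h]
  rfl

/-- **The marked points move by `M` when the embedding moves by `π^*M`**: for `M ∈ GL_{m+1}(Γ(T, 𝒪_T))`,
`markedTuple P ((π^*M) • ι) R j = M • markedTuple P ι R j` (★ `comp_lift_actCore` at the section `σ^{R j}`, and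
`σ^* π^* M = M`). [cite: GortzWedhorn2020, Definition 4.44 (p. 117)] -/
theorem markedTuple_lift_actCore (M : GL (Fin (Nat.card J + 1)) Γ(T, ⊤)) (j : Fin (Nat.card J + 2)) :
    letI : Algebra intU.{0} Γ(T, ⊤) := (intCast _).toAlgebra
    letI : Algebra intU.{0} Γ(P.A.X.left, ⊤) := (intCast _).toAlgebra
    markedTuple J P ((isPullback_projToSpec_projMap_terminal J Γ(P.A.X.left, ⊤)).lift P.A.X.left.toSpecΓ ι
        (terminal.hom_ext _ _) ≫ actCore J (Matrix.GeneralLinearGroup.map P.A.X.hom.appTop.hom M)) R j =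
      (isPullback_projToSpec_projMap_terminal J Γ(T, ⊤)).lift T.toSpecΓ (markedTuple J P ι R j)
        (terminal.hom_ext _ _) ≫ actCore J M := by
  rw [markedTuple_apply, markedTuple_apply, comp_lift_actCore, map_map_appTop_section]
  rfl

/-- **The frame locus of the marked points does not see a change of linear rigidification by `GL_{m+1}`**:
`frameLocus (markedTuple P ((π^*M) • ι) R) = frameLocus (markedTuple P ι R)` (★ `ProjFrame.frameLocus_lift_actCore`:
MFK Prop. 3.1, `U_R` is `PGL(m+1)`-stable). [cite: MumfordFogartyKirwan1994, Ch. 3 Proposition 3.1] -/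
theorem frameLocus_markedTuple_lift_actCore (M : GL (Fin (Nat.card J + 1)) Γ(T, ⊤)) :
    letI : Algebra intU.{0} Γ(P.A.X.left, ⊤) := (intCast _).toAlgebra
    frameLocus (markedTuple J P ((isPullback_projToSpec_projMap_terminal J Γ(P.A.X.left, ⊤)).lift
        P.A.X.left.toSpecΓ ι (terminal.hom_ext _ _) ≫
        actCore J (Matrix.GeneralLinearGroup.map P.A.X.hom.appTop.hom M)) R) =
      frameLocus (markedTuple J P ι R) := by
  letI : Algebra intU.{0} Γ(T, ⊤) := (intCast _).toAlgebra
  letI : Algebra intU.{0} Γ(P.A.X.left, ⊤) := (intCast _).toAlgebra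
  have e : markedTuple J P ((isPullback_projToSpec_projMap_terminal J Γ(P.A.X.left, ⊤)).lift
      P.A.X.left.toSpecΓ ι (terminal.hom_ext _ _) ≫
        actCore J (Matrix.GeneralLinearGroup.map P.A.X.hom.appTop.hom M)) R =
      fun j => (isPullback_projToSpec_projMap_terminal J Γ(T, ⊤)).lift T.toSpecΓ (markedTuple J P ι R j)
        (terminal.hom_ext _ _) ≫ actCore J M :=
    funext fun j => markedTuple_lift_actCore J P ι R M j
  rw [e]
  exact frameLocus_lift_actCore J (markedTuple J P ι R) M

end Marked

/-! ## § 2 The `R`-frame open `U_R(P)` and the condition `IsFrameOn` -/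

section FrameOpen

variable {T : Scheme.{0}} (P : PolarizedAbelianSchemeWithLevel g N δ T)
  (R : Fin (Nat.card J + 2) → (Fin g ⊕ Fin g → ZMod N))

/-- Unfolding `frameOpen`. [cite: MumfordFogartyKirwan1994, Ch. 3 Definition 3.3] -/
theorem frameOpen_def : frameOpen J P R =
    ⨆ U : T.Opens, ⨆ ι : (P.baseChange U.ι).A.X.left ⟶ projectiveSpaceInt J,
      ⨆ (_ : (P.baseChange U.ι).IsLinearRigidification J ι),
        U.ι ''ᵁ frameLocus (markedTuple J (P.baseChange U.ι) ι R) := rfl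

/-- **Every local linear rigidification contributes its frame locus**: for `ι` a linear rigidification of `P|_U`,
`U.ι (frameLocus (markedTuple P|_U ι R)) ≤ U_R(P)`. [cite: MumfordFogartyKirwan1994, Ch. 3 Definition 3.3] -/
theorem image_frameLocus_le_frameOpen (U : T.Opens) (ι : (P.baseChange U.ι).A.X.left ⟶ projectiveSpaceInt J)
    (hι : (P.baseChange U.ι).IsLinearRigidification J ι) :
    U.ι ''ᵁ frameLocus (markedTuple J (P.baseChange U.ι) ι R) ≤ frameOpen J P R := by
  rw [frameOpen_def]
  exact le_iSup_of_le U (le_iSup_of_le ι (le_iSup_of_le hι le_rfl))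

/-- Membership in `U_R(P)`: `t ∈ U_R(P)` iff `t` lies in an open `U` carrying a linear rigidification of `P|_U` through
which the `R`-marked points are a frame at `t`. [cite: MumfordFogartyKirwan1994, Ch. 3 Definition 3.3] -/
theorem mem_frameOpen_iff (t : T) : t ∈ frameOpen J P R ↔
    ∃ (U : T.Opens) (ι : (P.baseChange U.ι).A.X.left ⟶ projectiveSpaceInt J)
      (_ : (P.baseChange U.ι).IsLinearRigidification J ι),
      t ∈ U.ι ''ᵁ frameLocus (markedTuple J (P.baseChange U.ι) ι R) := by
  simp only [frameOpen_def, Opens.mem_iSup]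

/-- **`U_R` PULLS BACK ALONG RELATIONS (the inclusion that needs no choice)**: if `P″` over `T″` is the pull-back of
`P` along `u` (`IsBaseChangeVia`, MFK Def. 7.2's functoriality of `𝒜_{g,d,n}`), then `u⁻¹ U_R(P) ≤ U_R(P″)` — a local
linear rigidification `ι` of `P|_U` pulls back to the rigidification `m ≫ ι` of `P″|_{u⁻¹U}` (linear rigidifications
pull back along relations over a locally Noetherian base, ★ `IsBaseChangeVia.isLinearRigidification_comp`) whose
marked points are `u ≫` the old ones (`comp_markedTuple`), so its frame locus is the preimage (★ `preimage_frameLocus`,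
Mathlib `image_morphismRestrict_preimage`). [cite: MumfordFogartyKirwan1994, Ch. 7 §2 Definition 7.2 (p. 129)] -/
theorem preimage_frameOpen_le [IsLocallyNoetherian T] {T'' : Scheme.{0}} {P'' : PolarizedAbelianSchemeWithLevel g N δ T''}
    {u : T'' ⟶ T} {G : P''.A.X.left ⟶ P.A.X.left} {Ĝ : P''.D.hat.X.left ⟶ P.D.hat.X.left}
    (h : P''.IsBaseChangeVia P u G Ĝ) : u ⁻¹ᵁ frameOpen J P R ≤ frameOpen J P'' R := by
  intro t ht
  obtain ⟨U, ι, hι, hmem⟩ := (mem_frameOpen_iff J P R (u t)).mp ht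
  -- the relation restricted over `U`: `P″|_{u⁻¹U}` is the pull-back of `P|_U` along `u ∣_ U`
  have h1 : (P''.baseChange (u ⁻¹ᵁ U).ι).IsBaseChangeVia P ((u ∣_ U) ≫ U.ι)
      (pullback.fst P''.A.X.hom (u ⁻¹ᵁ U).ι ≫ G) (pullback.fst P''.D.hat.X.hom (u ⁻¹ᵁ U).ι ≫ Ĝ) := by
    rw [morphismRestrict_ι]
    exact (P''.baseChange_isBaseChangeVia (u ⁻¹ᵁ U).ι).trans h
  obtain ⟨m, mh, -, -, hrel⟩ := exists_isBaseChangeVia_of_comp h1 (P.baseChange_isBaseChangeVia U.ι)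
  refine (mem_frameOpen_iff J P'' R t).mpr ⟨u ⁻¹ᵁ U, m ≫ ι, hrel.isLinearRigidification_comp hι, ?_⟩
  have e2 : frameLocus (markedTuple J (P''.baseChange (u ⁻¹ᵁ U).ι) (m ≫ ι) R) =
      (u ∣_ U) ⁻¹ᵁ frameLocus (markedTuple J (P.baseChange U.ι) ι R) := by
    rw [preimage_frameLocus]
    exact congrArg frameLocus (funext fun j => (comp_markedTuple J R hrel j).symm)
  rw [e2, image_morphismRestrict_preimage]
  exact hmem

/-- Hence, along a relation, `u⁻¹ U_R(P) = T″` forces `U_R(P″) = T″`: **«`R`-framed» descends to pull-backs** (the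
choice-free half of the open-sub-functor clause). [cite: MumfordFogartyKirwan1994, Ch. 7 §2 Prop. 7.6 (p. 136)] -/
theorem isFrameOn_of_preimage_frameOpen_eq_top [IsLocallyNoetherian T] {T'' : Scheme.{0}}
    {P'' : PolarizedAbelianSchemeWithLevel g N δ T''} {u : T'' ⟶ T} {G : P''.A.X.left ⟶ P.A.X.left}
    {Ĝ : P''.D.hat.X.left ⟶ P.D.hat.X.left} (h : P''.IsBaseChangeVia P u G Ĝ)
    (hu : u ⁻¹ᵁ frameOpen J P R = ⊤) : IsFrameOn J P'' R :=
  top_le_iff.mp (hu.ge.trans (preimage_frameOpen_le J P R h))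

/-- **`𝓕_R` is a sub-functor: an `R`-framed triple stays `R`-framed after any pull-back** (`u⁻¹ ⊤ = ⊤`).
[cite: MumfordFogartyKirwan1994, Ch. 7 §2 Prop. 7.6 (p. 136)] -/
theorem IsFrameOn.of_isBaseChangeVia [IsLocallyNoetherian T] {T'' : Scheme.{0}}
    {P'' : PolarizedAbelianSchemeWithLevel g N δ T''} {u : T'' ⟶ T} {G : P''.A.X.left ⟶ P.A.X.left}
    {Ĝ : P''.D.hat.X.left ⟶ P.D.hat.X.left} (h : P''.IsBaseChangeVia P u G Ĝ) (hP : IsFrameOn J P R) :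
    IsFrameOn J P'' R :=
  isFrameOn_of_preimage_frameOpen_eq_top J P R h (by rw [(isFrameOn_iff J P R).mp hP, Scheme.Hom.preimage_top])

/-- In particular `P|_v` is `R`-framed when `P` is. [cite: MumfordFogartyKirwan1994, Ch. 7 §2 Prop. 7.6 (p. 136)] -/
theorem IsFrameOn.baseChange [IsLocallyNoetherian T] (hP : IsFrameOn J P R) {T'' : Scheme.{0}} (v : T'' ⟶ T) :
    IsFrameOn J (P.baseChange v) R := hP.of_isBaseChangeVia J P R (P.baseChange_isBaseChangeVia v)

end FrameOpen

/-! ## § 3 Any linear rigidification computes `U_R`; `U_R` commutes with pull-back along relations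

Inputs: **(hGL)** (MFK Prop. 7.6: rigidifications differ locally by `GL_{m+1}`, in the spelling
`M • q := ⟨toSpecΓ, q⟩ ≫ actCore J M` of ★ `Morphisms/ProjectiveFrameLocusLinearInvariance`) and **(hLR)** (Prop. 6.13 +
Def. 7.5: `π_*(L^Δ(λ)³)` is locally free of rank `6^g d = m + 1`, so local rigidifications exist). -/

section AnyRigidification

variable {T : Scheme.{0}} [IsLocallyNoetherian T] (P : PolarizedAbelianSchemeWithLevel g N δ T)
  (R : Fin (Nat.card J + 2) → (Fin g ⊕ Fin g → ZMod N))

/-- **A linear rigidification over an open immersion `v : V → T` contributes its frame locus to `U_R(P)`**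
(transport from `P|_v` to `P|_{v(V)}`: Mathlib `IsOpenImmersion.lift`, ★ `IsBaseChangeVia.isLinearRigidification_comp`).
[cite: MumfordFogartyKirwan1994, Ch. 3 §1 Definition 3.3 (p. 68)] -/
theorem image_frameLocus_le_frameOpen_of_isOpenImmersion {V : Scheme.{0}} (v : V ⟶ T) [IsOpenImmersion v]
    (κ : (P.baseChange v).A.X.left ⟶ projectiveSpaceInt J) (hκ : (P.baseChange v).IsLinearRigidification J κ) :
    v ''ᵁ frameLocus (markedTuple J (P.baseChange v) κ R) ≤ frameOpen J P R := by
  haveI : IsLocallyNoetherian V := isLocallyNoetherian_of_isOpenImmersion v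
  have Hr : Set.range v.opensRange.ι ⊆ Set.range v := by
    rw [Scheme.Opens.range_ι]
    rintro _ ⟨z, rfl⟩
    exact ⟨z, rfl⟩
  have he : IsOpenImmersion.lift v v.opensRange.ι Hr ≫ v = v.opensRange.ι := IsOpenImmersion.lift_fac v _ Hr
  -- `P|_{v(V)}` is the pull-back of `P|_v` along the comparison `e : v(V) → V`
  have h1 : (P.baseChange v.opensRange.ι).IsBaseChangeVia P (IsOpenImmersion.lift v v.opensRange.ι Hr ≫ v)
      (pullback.fst P.A.X.hom v.opensRange.ι) (pullback.fst P.D.hat.X.hom v.opensRange.ι) := by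
    rw [he]
    exact P.baseChange_isBaseChangeVia _
  obtain ⟨m, mh, -, -, hrel⟩ := exists_isBaseChangeVia_of_comp h1 (P.baseChange_isBaseChangeVia v)
  have e2 : frameLocus (markedTuple J (P.baseChange v.opensRange.ι) (m ≫ κ) R) =
      IsOpenImmersion.lift v v.opensRange.ι Hr ⁻¹ᵁ frameLocus (markedTuple J (P.baseChange v) κ R) := by
    rw [preimage_frameLocus]
    exact congrArg frameLocus (funext fun j => (comp_markedTuple J R hrel j).symm)
  rintro x ⟨z, hz, rfl⟩
  refine image_frameLocus_le_frameOpen J P R v.opensRange (m ≫ κ) (hrel.isLinearRigidification_comp hκ)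
    ⟨⟨v z, ⟨z, rfl⟩⟩, ?_, rfl⟩
  -- the comparison sends `⟨v z, _⟩` back to `z` (`v` is injective)
  have hz' : IsOpenImmersion.lift v v.opensRange.ι Hr ⟨v z, ⟨z, rfl⟩⟩ = z :=
    v.isOpenEmbedding.injective (by rw [← Scheme.Hom.comp_apply, he]; rfl)
  show (⟨v z, ⟨z, rfl⟩⟩ : ↥v.opensRange) ∈ frameLocus (markedTuple J (P.baseChange v.opensRange.ι) (m ≫ κ) R)
  rw [e2]
  show IsOpenImmersion.lift v v.opensRange.ι Hr ⟨v z, ⟨z, rfl⟩⟩ ∈ frameLocus (markedTuple J (P.baseChange v) κ R)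
  rw [hz']
  exact hz

variable {P} in
/-- **A GLOBAL linear rigidification contributes its whole frame locus** (`v = 𝟙`, ★ `IsLinearRigidification.baseChange`).
[cite: MumfordFogartyKirwan1994, Ch. 3 §1 Definition 3.3 (p. 68)] -/
theorem frameLocus_le_frameOpen {ι : P.A.X.left ⟶ projectiveSpaceInt J} (hι : P.IsLinearRigidification J ι) :
    frameLocus (markedTuple J P ι R) ≤ frameOpen J P R := by
  intro t ht
  refine image_frameLocus_le_frameOpen_of_isOpenImmersion J P R (𝟙 T) (pullback.fst P.A.X.hom (𝟙 T) ≫ ι)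
    (hι.baseChange (𝟙 T)) ⟨t, ?_, rfl⟩
  show t ∈ frameLocus (markedTuple J (P.baseChange (𝟙 T)) (pullback.fst P.A.X.hom (𝟙 T) ≫ ι) R)
  rw [← preimage_frameLocus_markedTuple]
  exact ht

variable {P} in
omit [IsLocallyNoetherian T] in
/-- A global linear rigidification yields the input (hLR) (its own cover and frames) — the form in which (hLR)
holds for the universal triple of a ★ `SiegelFramedCovariant`. [cite: MumfordFogartyKirwan1994, Ch. 7 §2 Def. 7.5 (p. 130)] -/
theorem IsLinearRigidification.exists_openCover_isFrameRigidification {ι : P.A.X.left ⟶ projectiveSpaceInt J}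
    (hι : P.IsLinearRigidification J ι) :
    ∃ 𝒰 : Scheme.OpenCover.{0} T, ∀ i, ∃ ι', (P.baseChange (𝒰.f i)).IsFrameRigidification J ι' := by
  obtain ⟨𝒰, h𝒰⟩ := hι
  exact ⟨𝒰, fun i => ⟨_, h𝒰 i⟩⟩

/-! ### The input (hGL) and the heads that use it -/
variable (hGL : ∀ ⦃S : Scheme.{0}⦄ [IsLocallyNoetherian S] (Q : PolarizedAbelianSchemeWithLevel g N δ S)
    (κ κ' : Q.A.X.left ⟶ projectiveSpaceInt J), Q.IsLinearRigidification J κ → Q.IsLinearRigidification J κ' →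
    ∃ 𝒰 : Scheme.OpenCover.{0} S, ∀ i, ∃ M : GL (Fin (Nat.card J + 1)) Γ(𝒰.X i, ⊤),
      letI : Algebra intU.{0} Γ((Q.baseChange (𝒰.f i)).A.X.left, ⊤) := (intCast _).toAlgebra
      pullback.fst Q.A.X.hom (𝒰.f i) ≫ κ' =
        (isPullback_projToSpec_projMap_terminal J Γ((Q.baseChange (𝒰.f i)).A.X.left, ⊤)).lift
            (Q.baseChange (𝒰.f i)).A.X.left.toSpecΓ (pullback.fst Q.A.X.hom (𝒰.f i) ≫ κ) (terminal.hom_ext _ _) ≫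
          actCore J (Matrix.GeneralLinearGroup.map (Q.baseChange (𝒰.f i)).A.X.hom.appTop.hom M))

include hGL
variable {P} in
/-- **ANY GLOBAL LINEAR RIGIDIFICATION `ι` COMPUTES `U_R`: `U_R(P) = frameLocus (markedTuple P ι R)`** — a second
local rigidification `κ` differs from `ι` locally by some `M ∈ GL_{m+1}` (input (hGL), Prop. 7.6), and the frame locus
does not see `M` (★ `frameLocus_lift_actCore`; Prop. 3.1: `U_R` is `PGL(m+1)`-stable).
[cite: MumfordFogartyKirwan1994, Ch. 3 §1 Proposition 3.1 (p. 68)] [cite: MumfordFogartyKirwan1994, Ch. 7 §2 Prop. 7.6 (p. 136)] -/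
theorem frameOpen_eq_frameLocus {ι : P.A.X.left ⟶ projectiveSpaceInt J} (hι : P.IsLinearRigidification J ι) :
    frameOpen J P R = frameLocus (markedTuple J P ι R) := by
  refine le_antisymm ?_ (frameLocus_le_frameOpen J R hι)
  intro t ht
  obtain ⟨V, κ, hκ, hmem⟩ := (mem_frameOpen_iff J P R t).mp ht
  obtain ⟨y, hy, rfl⟩ := hmem
  -- compare `κ` with `ι|_V` on a cover of `V`
  obtain ⟨𝒰, h𝒰⟩ := hGL (P.baseChange V.ι) (pullback.fst P.A.X.hom V.ι ≫ ι) κ (hι.baseChange V.ι) hκ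
  obtain ⟨i, z, rfl⟩ := 𝒰.exists_eq y
  obtain ⟨M, hM⟩ := h𝒰 i
  -- read `z ∈ (𝒰.f i)⁻¹ (frame locus of κ)` through `κ|_i = M • ι|_i` and the `GL`-invariance of the frame locus
  have hz : z ∈ 𝒰.f i ⁻¹ᵁ frameLocus (markedTuple J (P.baseChange V.ι) κ R) := hy
  rw [preimage_frameLocus_markedTuple, hM, frameLocus_markedTuple_lift_actCore, ← preimage_frameLocus_markedTuple]
    at hz
  have hy' : 𝒰.f i z ∈ frameLocus (markedTuple J (P.baseChange V.ι) (pullback.fst P.A.X.hom V.ι ≫ ι) R) := hz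
  rw [← preimage_frameLocus_markedTuple] at hy'
  exact hy'

variable {P} in
/-- **`U_R = T` iff the marked points are a frame through the given global rigidification.**
[cite: MumfordFogartyKirwan1994, Ch. 7 §2 Prop. 7.6 (p. 136)] -/
theorem isFrameOn_iff_frameLocus_eq_top {ι : P.A.X.left ⟶ projectiveSpaceInt J} (hι : P.IsLinearRigidification J ι) :
    IsFrameOn J P R ↔ frameLocus (markedTuple J P ι R) = ⊤ := by
  rw [isFrameOn_iff, frameOpen_eq_frameLocus J R hGL hι]

/-- **ANY LOCAL LINEAR RIGIDIFICATION `ι` of `P|_U` COMPUTES `U_R` ON `U`**: `U_R(P) ∩ U = U.ι (frameLocus …)`.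
[cite: MumfordFogartyKirwan1994, Ch. 3 §1 Proposition 3.1 (p. 68)] [cite: MumfordFogartyKirwan1994, Ch. 7 §2 Prop. 7.6 (p. 136)] -/
theorem frameOpen_inf_eq (U : T.Opens) {ι : (P.baseChange U.ι).A.X.left ⟶ projectiveSpaceInt J}
    (hι : (P.baseChange U.ι).IsLinearRigidification J ι) :
    frameOpen J P R ⊓ U = U.ι ''ᵁ frameLocus (markedTuple J (P.baseChange U.ι) ι R) := by
  refine le_antisymm ?_ (le_inf (image_frameLocus_le_frameOpen J P R U ι hι) (U.ι_image_le _))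
  rintro t ⟨ht, htU⟩
  refine ⟨⟨t, htU⟩, ?_, rfl⟩
  show (⟨t, htU⟩ : ↥U) ∈ frameLocus (markedTuple J (P.baseChange U.ι) ι R)
  rw [← frameOpen_eq_frameLocus J R hGL hι]
  exact preimage_frameOpen_le J P R (P.baseChange_isBaseChangeVia U.ι) ht

/-- **`U_R` COMMUTES WITH PULL-BACK ALONG RELATIONS: `u⁻¹ U_R(P) = U_R(P″)`** for `P″ ≅ u^*P` — `≤` is
`preimage_frameOpen_le`; for `≥`, at `t ∈ U_R(P″)` a rigidification `κ` of `P` near `u t` (input (hLR)) pulls back to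
`P″` near `t` (★ `IsBaseChangeVia.isLinearRigidification_comp`), where it computes `U_R(P″)` (`frameOpen_eq_frameLocus`,
input (hGL)), and frame loci pull back (★ `preimage_frameLocus`): the open-sub-functor clause of `𝓕_R`.
[cite: MumfordFogartyKirwan1994, Ch. 7 §2 Prop. 7.6 (p. 136)] [cite: MumfordFogartyKirwan1994, Ch. 3 §1 Proposition 3.1 (p. 68)] -/
theorem preimage_frameOpen {T'' : Scheme.{0}} [IsLocallyNoetherian T''] {P'' : PolarizedAbelianSchemeWithLevel g N δ T''}
    {u : T'' ⟶ T} {G : P''.A.X.left ⟶ P.A.X.left} {Ĝ : P''.D.hat.X.left ⟶ P.D.hat.X.left}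
    (h : P''.IsBaseChangeVia P u G Ĝ)
    (hLR : ∃ 𝒰 : Scheme.OpenCover.{0} T, ∀ i, ∃ ι, (P.baseChange (𝒰.f i)).IsFrameRigidification J ι) :
    u ⁻¹ᵁ frameOpen J P R = frameOpen J P'' R := by
  refine le_antisymm (preimage_frameOpen_le J P R h) ?_
  intro t ht
  -- a rigidification `κ` of `P` near `u t`
  obtain ⟨𝒱, h𝒱⟩ := hLR
  obtain ⟨i, y, hy⟩ := 𝒱.exists_eq (u t)
  obtain ⟨κ, hκ⟩ := h𝒱 i
  haveI : IsLocallyNoetherian (𝒱.X i) := isLocallyNoetherian_of_isOpenImmersion (𝒱.f i)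
  have hκL : (P.baseChange (𝒱.f i)).IsLinearRigidification J κ := hκ.isLinearRigidification
  -- the open `W = u⁻¹(range 𝒱ᵢ) ∋ t` of `T″` and its map `p : W → 𝒱ᵢ` over `u`
  have Hr : Set.range ((u ⁻¹ᵁ (𝒱.f i).opensRange).ι ≫ u) ⊆ Set.range (𝒱.f i) := by
    rintro _ ⟨s, rfl⟩
    exact s.2
  have hp : IsOpenImmersion.lift (𝒱.f i) _ Hr ≫ 𝒱.f i = (u ⁻¹ᵁ (𝒱.f i).opensRange).ι ≫ u :=
    IsOpenImmersion.lift_fac _ _ Hr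
  -- `P″|_W` is the pull-back of `P|_{𝒱ᵢ}` along `p`; `κ` pulls back to a GLOBAL rigidification of `P″|_W`
  have h1 : (P''.baseChange (u ⁻¹ᵁ (𝒱.f i).opensRange).ι).IsBaseChangeVia P
      (IsOpenImmersion.lift (𝒱.f i) _ Hr ≫ 𝒱.f i)
      (pullback.fst P''.A.X.hom (u ⁻¹ᵁ (𝒱.f i).opensRange).ι ≫ G)
      (pullback.fst P''.D.hat.X.hom (u ⁻¹ᵁ (𝒱.f i).opensRange).ι ≫ Ĝ) := by
    rw [hp]
    exact (P''.baseChange_isBaseChangeVia _).trans h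
  obtain ⟨m, mh, -, -, hrel⟩ := exists_isBaseChangeVia_of_comp h1 (P.baseChange_isBaseChangeVia (𝒱.f i))
  have hW : frameOpen J (P''.baseChange (u ⁻¹ᵁ (𝒱.f i).opensRange).ι) R =
      IsOpenImmersion.lift (𝒱.f i) _ Hr ⁻¹ᵁ frameLocus (markedTuple J (P.baseChange (𝒱.f i)) κ R) := by
    rw [frameOpen_eq_frameLocus J R hGL (hrel.isLinearRigidification_comp hκL), preimage_frameLocus]
    congr 1
    funext j
    exact (comp_markedTuple J R hrel j).symm
  -- `t`, as a point of `W`, lies in `U_R(P″|_W)`; push it to `𝒱ᵢ`, then to `T`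
  have htW : u t ∈ (𝒱.f i).opensRange := ⟨y, hy⟩
  have ht' : (⟨t, htW⟩ : ↥(u ⁻¹ᵁ (𝒱.f i).opensRange)) ∈
      frameOpen J (P''.baseChange (u ⁻¹ᵁ (𝒱.f i).opensRange).ι) R :=
    preimage_frameOpen_le J P'' R (P''.baseChange_isBaseChangeVia _) ht
  rw [hW] at ht'
  have key : 𝒱.f i (IsOpenImmersion.lift (𝒱.f i) _ Hr ⟨t, htW⟩) ∈ frameOpen J P R :=
    image_frameLocus_le_frameOpen_of_isOpenImmersion J P R (𝒱.f i) κ hκL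
      ⟨IsOpenImmersion.lift (𝒱.f i) _ Hr ⟨t, htW⟩, ht', rfl⟩
  have e : 𝒱.f i (IsOpenImmersion.lift (𝒱.f i) _ Hr ⟨t, htW⟩) = u t := by rw [← Scheme.Hom.comp_apply, hp]; rfl
  rwa [e] at key

/-- **The consumer clause `hFr` of ★ `SiegelFineModuliScheme.classify_of_openCharts`**: along a relation `P″ ≅ u^*P`,
«`P″` is `R`-framed» iff «`u` factors through `U_R(P)`» (isomorphism-invariance and base change of `𝓕_R` in one
clause). [cite: MumfordFogartyKirwan1994, Ch. 7 §2 Prop. 7.6 (p. 136)] -/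
theorem isFrameOn_iff_preimage_frameOpen_eq_top {T'' : Scheme.{0}} [IsLocallyNoetherian T'']
    {P'' : PolarizedAbelianSchemeWithLevel g N δ T''} {u : T'' ⟶ T} {G : P''.A.X.left ⟶ P.A.X.left}
    {Ĝ : P''.D.hat.X.left ⟶ P.D.hat.X.left} (h : P''.IsBaseChangeVia P u G Ĝ)
    (hLR : ∃ 𝒰 : Scheme.OpenCover.{0} T, ∀ i, ∃ ι, (P.baseChange (𝒰.f i)).IsFrameRigidification J ι) :
    IsFrameOn J P'' R ↔ u ⁻¹ᵁ frameOpen J P R = ⊤ := by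
  rw [isFrameOn_iff, preimage_frameOpen J P R hGL h hLR]

end AnyRigidification

end PolarizedAbelianSchemeWithLevel

end Literature.AlgebraicGeometry.AbelianSchemes
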